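import Summits.HubbardSuperconductivity.HubbardSuperconductivity.Theorems.DeformationLadderApproximatingHamiltonianGCSourcedRectangles
import Summits.HubbardSuperconductivity.HubbardSuperconductivity.Theorems.WeakCouplingBCSWcbcsBcsConstructionSubadditiveLimit2D

/-!
# Route `DeformationLadder`, item `ApproximatingHamiltonianGC` (stmt-HubbardSuperconductivity-1895):
# the thermodynamic limit of the pair-sourced ground-state energy density along free-boundary squares

Support file (`--supports stmt-HubbardSuperconductivity-1895`), continuing `…SourcedBoxes.lean`. For the
`d`-wave pair-sourced Hubbard rectangles (`Lex (Fin m × Fin n)`, graph and weight `h·d(q−p)/√2` pulled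
back from `ℤ²`) the square energies `T(L,L;h)` satisfy the three hypotheses of the tree's Fekete lemma
along squares (`stub_subadditiveLimit2D`): volume lower bound `−cL²`, tiling `T(kM,kM) ≤ k²T(M,M) +
2(4|t|+8|h|)k²M` (stack, transpose, stack; the square is transposition-symmetric in `h ↦ −h`), and
monotonicity `T(L,L) ≤ T(M,M) + 2(4|t|+8|h|)L` (`M ≤ L`, cutting off strips of energy `≤ 0`). Hence
`dlsb_rect_energyDensity_limit`: `T(L+1,L+1;h)/(L+1)²` converges for every `t, U, μ, h`. The rectangle
energies are abstracted as a function `T` given by a HYPOTHESIS `hT` inside the section (an equation,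
not a definition); the final statement is free of it.

Ruelle, *Statistical Mechanics: Rigorous Results* (1969) §2.2. No definitions are introduced.
-/

set_option linter.dupNamespace false

noncomputable section

namespace Summit.HubbardSuperconductivity.HubbardSuperconductivity.Theorems

open Matrix Finset Literature.MathematicalPhysics.QuantumLattice
open Literature.MathematicalPhysics.QuantumLattice.ThermodynamicLimit
open Literature.Barriers.HubbardSuperconductivity (bondPair bondPair_conjTranspose norm_bondPair_le_two)
open scoped ComplexOrder Matrix.Norms.L2Operator
open Literature.Probability.LatticeModels

/-! ### The thermodynamic limit of the pair-sourced energy density along squares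

To keep statements readable, the rectangle energies are abstracted into a function
`T m n h = E₀(m × n rectangle, d-wave weight of strength h)` given as a HYPOTHESIS `hT` (an
equation, not a definition); the final statement `dlsb_rect_energyDensity_limit` is free of it. -/

section SquareLimit

open Filter Topology

variable (t U μ : ℝ) (T : ℕ → ℕ → ℝ → ℝ)
  (hT : ∀ (m n : ℕ) (h : ℝ), T m n h =
    (hamiltonianWith ((zdGraph 2).comap
        (fun p : Lex (Fin m × Fin n) => ![((ofLex p).1 : ℤ), ((ofLex p).2 : ℤ)])) t U μ -
      ∑ p : Lex (Fin m × Fin n), ∑ q : Lex (Fin m × Fin n),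
        ((h * (dWaveFormFactor (![((ofLex q).1 : ℤ), ((ofLex q).2 : ℤ)] -
          ![((ofLex p).1 : ℤ), ((ofLex p).2 : ℤ)]) / Real.sqrt 2) : ℝ) : ℂ) •
          (bondPair p q + (bondPair p q)ᴴ)).groundEnergy)
include hT

/-- Row cut, abstract form: `T(m₁+m₂, n) ≤ T(m₁, n) + T(m₂, n) + (4|t|+8|h|)n`. [folklore] -/
theorem dlsb_T_rowCut (m₁ m₂ n : ℕ) (h : ℝ) :
    T (m₁ + m₂) n h ≤ T m₁ n h + T m₂ n h + (4 * |t| + 8 * |h|) * n := by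
  rw [hT, hT, hT]
  exact dlsb_rect_rowCut_le rfl n t U μ h

/-- Transposition, abstract form: `T(n, m; h) = T(m, n; −h)`. [folklore] -/
theorem dlsb_T_transpose (m n : ℕ) (h : ℝ) : T n m h = T m n (-h) := by
  rw [hT, hT]
  exact dlsb_rect_transpose m n t U μ h

/-- Stacking, abstract form: `T(kM, n) ≤ k T(M, n) + (4|t|+8|h|) n k`. [folklore] -/
theorem dlsb_T_stack (M n k : ℕ) (h : ℝ) :
    T (k * M) n h ≤ (k : ℝ) * T M n h + (4 * |t| + 8 * |h|) * n * k := by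
  rw [hT, hT]
  exact dlsb_rect_stack_le M n k t U μ h

/-- Vacuum bound, abstract form: `T(m, n; h) ≤ 0`. [folklore] -/
theorem dlsb_T_nonpos (m n : ℕ) (h : ℝ) : T m n h ≤ 0 := by
  rw [hT]
  exact dlsb_groundEnergy_sourced_nonpos _ _ t U μ

/-- Volume lower bound, abstract form: `T(L, L; h) ≥ −(5(2|t|+|U|+2|μ|) + 16|h|) L²`. [folklore] -/
theorem dlsb_T_lower (L : ℕ) (h : ℝ) :
    -((5 * (2 * |t| + |U| + 2 * |μ|) + 16 * |h|) * (L : ℝ) ^ 2) ≤ T L L h := by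
  rw [hT]
  refine le_trans (le_of_eq ?_) (dlsb_neg_le_groundEnergy_sourced ((zdGraph 2).comap
      (fun p : Lex (Fin L × Fin L) => ![((ofLex p).1 : ℤ), ((ofLex p).2 : ℤ)])) (Δ := 4)
    WcbcsBoxTiling.card_filter_rect_adj_le
    (fun p q : Lex (Fin L × Fin L) => h * (dWaveFormFactor (![((ofLex q).1 : ℤ), ((ofLex q).2 : ℤ)] -
      ![((ofLex p).1 : ℤ), ((ofLex p).2 : ℤ)]) / Real.sqrt 2)) (abs_nonneg h)
    (fun p q => dlsb_abs_coordWeight_le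
      (fun p : Lex (Fin L × Fin L) => ![((ofLex p).1 : ℤ), ((ofLex p).2 : ℤ)]) h p q)
    (fun p q hpq => dlsb_comap_adj_of_coordWeight_ne_zero _ h _ _ hpq) t U μ)
  rw [WcbcsBoxTiling.card_rect]
  push_cast
  ring

/-- **Tiling sub-additivity of squares**: `T(kM, kM) ≤ k² T(M, M) + 2(4|t|+8|h|) k² M` (stack `k`
strips `M × kM`, transpose, stack again; the square is transposition-symmetric). [folklore] -/
theorem dlsb_T_tiling (k M : ℕ) (h : ℝ) :
    T (k * M) (k * M) h ≤ (k : ℝ) ^ 2 * T M M h + 2 * (4 * |t| + 8 * |h|) * (k : ℝ) ^ 2 * M := by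
  have h1 := dlsb_T_stack t U μ T hT M (k * M) k h
  have h2 : T M (k * M) h = T (k * M) M (-h) := dlsb_T_transpose t U μ T hT (k * M) M h
  have h3 := dlsb_T_stack t U μ T hT M M k (-h)
  have h4 : T M M (-h) = T M M h := by
    rw [dlsb_T_transpose t U μ T hT M M (-h), neg_neg]
  rw [abs_neg] at h3
  rw [h2] at h1
  rw [h4] at h3
  have hk : (0 : ℝ) ≤ k := Nat.cast_nonneg k
  have h5 := mul_le_mul_of_nonneg_left h3 hk
  push_cast at h1 h5 ⊢
  nlinarith [h1, h5]

/-- **Monotonicity up to a boundary cost**: `T(L, L) ≤ T(M, M) + 2(4|t|+8|h|) L` for `M ≤ L`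
(cut off the complementary strips, of energy `≤ 0`). [folklore] -/
theorem dlsb_T_mono (L M : ℕ) (hML : M ≤ L) (h : ℝ) :
    T L L h ≤ T M M h + 2 * (4 * |t| + 8 * |h|) * L := by
  obtain ⟨D, rfl⟩ := Nat.exists_eq_add_of_le hML
  have h1 := dlsb_T_rowCut t U μ T hT M D (M + D) h
  have h2 := dlsb_T_nonpos t U μ T hT D (M + D) h
  have h3 : T M (M + D) h = T (M + D) M (-h) := dlsb_T_transpose t U μ T hT (M + D) M h
  have h4 := dlsb_T_rowCut t U μ T hT M D M (-h)
  have h5 := dlsb_T_nonpos t U μ T hT D M (-h)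
  have h6 : T M M (-h) = T M M h := by
    rw [dlsb_T_transpose t U μ T hT M M (-h), neg_neg]
  rw [abs_neg] at h4
  have hC : 0 ≤ 4 * |t| + 8 * |h| := by positivity
  have hM : (M : ℝ) ≤ ((M + D : ℕ) : ℝ) := by exact_mod_cast Nat.le_add_right M D
  have hM0 : (0 : ℝ) ≤ M := Nat.cast_nonneg M
  have h7 := mul_le_mul_of_nonneg_left hM hC
  push_cast at *
  linarith

/-- **The pair-sourced energy density of the squares converges** (abstract form): Fekete's lemma
along squares with boundary terms (`stub_subadditiveLimit2D`). [folklore] -/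
theorem dlsb_T_limit (h : ℝ) :
    ∃ ℓ : ℝ, Tendsto (fun L : ℕ => T (L + 1) (L + 1) h / ((L + 1 : ℕ) : ℝ) ^ 2) atTop (𝓝 ℓ) :=
  stub_subadditiveLimit2D (fun L => T L L h) (2 * (4 * |t| + 8 * |h|))
    (5 * (2 * |t| + |U| + 2 * |μ|) + 16 * |h|) (by positivity)
    (fun L => by
      have := dlsb_T_lower t U μ T hT L h
      linarith)
    (fun k M => dlsb_T_tiling t U μ T hT k M h)
    (fun L M hML => dlsb_T_mono t U μ T hT L M hML h)

end SquareLimit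

/-- **Thermodynamic limit of the ground-state energy density of the pair-sourced Hubbard squares**
(free boundary conditions): for every `t, U, μ, h` the ground energy of
`hamiltonianWith (box (L+1)²) t U μ − Σ_{p,q} h·d(q − p)/√2 · (b_{pq} + b_{pq}ᴴ)` divided by
`(L+1)²` converges as `L → ∞`. Ruelle (1969) §2. [folklore] -/
theorem dlsb_rect_energyDensity_limit (t U μ h : ℝ) :
    ∃ ℓ : ℝ, Filter.Tendsto (fun L : ℕ => (hamiltonianWith ((zdGraph 2).comap
        (fun p : Lex (Fin (L + 1) × Fin (L + 1)) => ![((ofLex p).1 : ℤ), ((ofLex p).2 : ℤ)])) t U μ -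
      ∑ p : Lex (Fin (L + 1) × Fin (L + 1)), ∑ q : Lex (Fin (L + 1) × Fin (L + 1)),
        ((h * (dWaveFormFactor (![((ofLex q).1 : ℤ), ((ofLex q).2 : ℤ)] -
          ![((ofLex p).1 : ℤ), ((ofLex p).2 : ℤ)]) / Real.sqrt 2) : ℝ) : ℂ) •
          (bondPair p q + (bondPair p q)ᴴ)).groundEnergy / ((L + 1 : ℕ) : ℝ) ^ 2)
      Filter.atTop (nhds ℓ) :=
  dlsb_T_limit t U μ (fun m n h => (hamiltonianWith ((zdGraph 2).comap
        (fun p : Lex (Fin m × Fin n) => ![((ofLex p).1 : ℤ), ((ofLex p).2 : ℤ)])) t U μ -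
      ∑ p : Lex (Fin m × Fin n), ∑ q : Lex (Fin m × Fin n),
        ((h * (dWaveFormFactor (![((ofLex q).1 : ℤ), ((ofLex q).2 : ℤ)] -
          ![((ofLex p).1 : ℤ), ((ofLex p).2 : ℤ)]) / Real.sqrt 2) : ℝ) : ℂ) •
          (bondPair p q + (bondPair p q)ᴴ)).groundEnergy) (fun _ _ _ => rfl) h

end Summit.HubbardSuperconductivity.HubbardSuperconductivity.Theorems

end
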